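import Literature.AnabelianGeometry.EtaleTheta.ThetaRigidityLevels
import Literature.AnabelianGeometry.EtaleTheta.Discharge.Sec2AutOverProofs
import HarnessLib

/-!
# [EtTh] Cor. 2.18 (iv) for `ThetaEnvData` with TRIVIAL base group `G_K = 1`: `D_Y = 1`, a lifting
# criterion (surjectivity) and a rigidity criterion (fibres) — proof-only

S. Mochizuki, *The Étale Theta Function …* [EtTh], Publ. RIMS **45** (2009), §2, Def. 2.13 and Cor. 2.18 (iv),
PRIMS text pp. 47, 61–63 (locators `p.N` = PDF pages; bib key `MochizukiEtTh2009`).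

PROOF-ONLY companion (no `def`, no instance, no new named fact) of `MonoThetaEnv.lean` /
`ThetaRigidityLevels.lean` (abc-iut-L2-t2): generic criteria, over a bare `T : ThetaEnvData N` whose base
group `G_K` is trivial (`[Subsingleton T.G]` — so the cyclotomic character is trivial and the envelope
`Π^tp_Y[μ_N]` is the direct product `μ_N × Π^tp_Y`), for the two `ThetaEnvData`-level clauses of
Cor. 2.18 (iv) (FACT rows F-0638 `Cor218_iv_fibre`, F-0639 `Cor218_iv_surjective`):

* `conj_inMu_eq_one`, `muConjClass_eq_singleton_of_subsingleton`, `shift_inflated_eq_one`,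
  `conjX_eq_conj_algSection`, `DY_eq_bot_of_forall_exists_conj` — the cyclotome is central, `μ_N`-conjugacy
  classes are singletons, the Kummer generators of `D_Y` are trivial, and if `Π^tp_X` acts on `Π^tp_Y` by
  inner automorphisms of `Π^tp_Y` then `D_Y = 1`;
* `exists_iso_over_of_coeff`, `cor218_iv_surjective_of_stable` — LIFTING: an automorphism `γ` of `Π^tp_X`
  preserving `Π^tp_Y`, `Π^tp_Ÿ` and acting on the theta cocycle through a coefficient automorphism `ψ_γ`
  (`ψ_γ ∘ η = η ∘ γ`) lifts to the model automorphism `(u, y) ↦ (ψ_γ u, γ y)` (the shape `A₀` of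
  abc-iut-L2-t10's `cor218_iv_surjective_of`, here with `D_Y = 1`);
* `iso_apply_sTheta_of_over_id`, `cor218_iv_fibre_of_rigid` — RIGIDITY: if `Hom(Π^tp_Y, μ_N) = 1` and every
  theta cocycle is onto `μ_N`, every model automorphism over `id_{Π^tp_Y}` is the identity, so the fibre
  clause holds (converse clause = `exists_iso_eq_twist`).

Consumed by `ThetaRigidityLevelsDihedralWitness.lean` (the `ℤ × D₃` witness where BOTH clauses hold with
`μ_3 ≠ 1`); they also re-derive `RigidData.ToyN3.cor218_iv_surjective`.  HONEST FRAMING: statements about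
the cell's own typing over an abstract interface; nothing here bears on [EtTh] (refereed) or on [IUTchIII]
Cor. 3.12; no side taken; typed ≠ proved.  Cell `abc-iut`, seat abc-iut-f-151 (tranche 151).
-/

namespace Literature.AnabelianGeometry.EtaleTheta

universe u

/-! ## §1. Generic criteria for `ThetaEnvData` with `G_K = 1` -/

namespace ThetaEnvData

variable {N : ℕ+} (T : ThetaEnvData.{u} N)

section SubsingletonG

variable [Subsingleton T.G]

/-- With `G_K = 1` the cyclotomic character is trivial on `Π^tp_Y`.
[cite: MochizukiEtTh2009, Def 2.10 p.44] -/
theorem chi_augY_eq_one (g : T.PiY) : T.chi (T.augY g) = 1 := by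
  rw [Subsingleton.elim (T.augY g) 1, map_one]

/-- With `G_K = 1` the envelope is the direct product `μ_N × Π^tp_Y`: left components multiply.
[cite: MochizukiEtTh2009, Def 2.10 p.44] -/
theorem mul_left_eq (x y : T.env) : (x * y).left = x.left * y.left := by
  rw [SemidirectProduct.mul_left]
  change x.left * (T.chi (T.augY x.right)) y.left = _
  rw [chi_augY_eq_one, MulAut.one_apply]

/-- With `G_K = 1`, left components of inverses are inverses. [cite: MochizukiEtTh2009, Def 2.10 p.44] -/
theorem inv_left_eq (x : T.env) : x⁻¹.left = x.left⁻¹ := by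
  rw [SemidirectProduct.inv_left]
  change (T.chi (T.augY x.right⁻¹)) x.left⁻¹ = _
  rw [chi_augY_eq_one, MulAut.one_apply]

/-- With `G_K = 1` the cyclotome is central: conjugation by `μ_N` is trivial on the envelope.
[cite: MochizukiEtTh2009, Def 2.10 p.44] -/
theorem conj_inMu_eq_one (c : T.mu) : MulAut.conj (CycEnvelope.inMu T.augY T.chi c) = 1 := by
  refine MulEquiv.ext fun x => ?_
  rw [MulAut.conj_apply, MulAut.one_apply]
  refine SemidirectProduct.ext ?_ ?_
  · rw [mul_left_eq, mul_left_eq, inv_left_eq, SemidirectProduct.left_inl, mul_inv_cancel_comm]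
  · simp

/-- With `G_K = 1` every `μ_N`-conjugacy class of subgroups is a singleton.
[cite: MochizukiEtTh2009, Def 2.10 p.44] -/
theorem muConjClass_eq_singleton_of_subsingleton (H : Subgroup T.env) :
    CycEnvelope.muConjClass T.augY T.chi H = {H} := by
  have hid : ∀ a : T.mu,
      H.map (MulAut.conj (CycEnvelope.inMu T.augY T.chi a)).toMonoidHom = H := by
    intro a
    rw [conj_inMu_eq_one]
    exact Subgroup.map_id H
  ext K
  simp only [CycEnvelope.muConjClass, Set.mem_setOf_eq, Set.mem_singleton_iff, hid, exists_const]

/-- With `G_K = 1` every cocycle inflated from `G_K` is trivial, so its Kummer shift is the identity.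
[cite: MochizukiEtTh2009, Def 2.13(i) p.47] -/
theorem shift_inflated_eq_one {δ : T.G → T.mu}
    (hδ : CycEnvelope.IsEnvCocycle T.augY T.chi (δ ∘ T.augY)) : CycEnvelope.shift hδ = 1 := by
  have h1 : δ (T.augY 1) = 1 := by
    have := hδ 1 1
    simp only [Function.comp_apply, mul_one, chi_augY_eq_one, MulAut.one_apply] at this
    exact mul_eq_left.mp this.symm
  refine MulEquiv.ext fun x => SemidirectProduct.ext ?_ rfl
  change x.left * δ (T.augY x.right) = x.left
  rw [Subsingleton.elim (T.augY x.right) (T.augY 1), h1, mul_one]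

/-- With `G_K = 1`, if `x ∈ Π^tp_X` acts on `Π^tp_Y` as the inner automorphism of `y ∈ Π^tp_Y`, then
`conj_x` on the envelope is the inner automorphism of `s^alg(y)`. [cite: MochizukiEtTh2009, Def 2.13(i) p.47] -/
theorem conjX_eq_conj_algSection (x : T.PiX) (y : T.PiY)
    (hy : ∀ h : T.PiY, x * (h : T.PiX) * x⁻¹ = (y : T.PiX) * h * (y : T.PiX)⁻¹) :
    T.conjX x = MulAut.conj (CycEnvelope.algSection T.augY T.chi y) := by
  refine MulEquiv.ext fun z => ?_
  rw [MulAut.conj_apply]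
  refine SemidirectProduct.ext ?_ ?_
  · change T.chi (T.aug x) z.left = _
    rw [Subsingleton.elim (T.aug x) 1, map_one, MulAut.one_apply, mul_left_eq, mul_left_eq,
      inv_left_eq, SemidirectProduct.left_inr, one_mul, inv_one, mul_one]
  · apply Subtype.ext
    change x * (z.right : T.PiX) * x⁻¹ = _
    rw [hy z.right]
    simp

/-- **`D_Y = 1` criterion**: with `G_K = 1`, if every element of `Π^tp_X` acts on `Π^tp_Y` by an inner
automorphism of `Π^tp_Y`, then `D_Y ⊆ Out(Π^tp_Y[μ_N])` is trivial (its Kummer generators are trivial and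
its `Gal(Y/X)` generators inner). [cite: MochizukiEtTh2009, Def 2.13(i) p.47] -/
theorem DY_eq_bot_of_forall_exists_conj
    (hinner : ∀ x : T.PiX, ∃ y : T.PiY, ∀ h : T.PiY,
      x * (h : T.PiX) * x⁻¹ = (y : T.PiX) * h * (y : T.PiX)⁻¹) :
    T.DY = ⊥ := by
  refine (Subgroup.closure_eq_bot_iff).mpr ?_
  rintro x (⟨δ, hδ, hc, rfl⟩ | ⟨g, hc, rfl⟩)
  · rw [Set.mem_singleton_iff]
    have h1 : (⟨CycEnvelope.shift hδ, hc⟩ : contMulAut T.env) = 1 :=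
      Subtype.ext (T.shift_inflated_eq_one hδ)
    rw [h1, map_one]
  · rw [Set.mem_singleton_iff]
    obtain ⟨y, hy⟩ := hinner g
    exact (QuotientGroup.eq_one_iff _).mpr ⟨_, (T.conjX_eq_conj_algSection g y hy).symm⟩

/-- **Cor. 2.18 (iv) surjectivity — lifting criterion for `G_K = 1` data**: if `D_Y = 1`, an
automorphism `γ` of `Π^tp_X` preserving `Π^tp_Y` and `Π^tp_Ÿ` which acts on the theta cocycle `η`
through a coefficient automorphism `ψ` (`ψ (η y) = η (γ y)`) lifts to the automorphism
`(u, y) ↦ (ψ u, γ y)` of the model mono-theta environment `M(η)`, lying over `γ|_{Π^tp_Y}`.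
[cite: MochizukiEtTh2009, Cor 2.18(iv) p.61] -/
theorem exists_iso_over_of_coeff (hD : T.DY = ⊥) {η : T.PiYdd → T.mu} (hη : η ∈ T.thetaCocycles)
    (γ : T.PiX ≃ₜ* T.PiX) (hY : ∀ g : T.PiX, g ∈ T.PiY → γ g ∈ T.PiY)
    (hY' : ∀ g : T.PiX, g ∈ T.PiY → γ.symm g ∈ T.PiY)
    (hdd : ∀ g : T.PiX, g ∈ T.PiYdd → γ g ∈ T.PiYdd)
    (hdd' : ∀ g : T.PiX, g ∈ T.PiYdd → γ.symm g ∈ T.PiYdd)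
    (ψ : T.mu ≃* T.mu) (hψ : ∀ y : T.PiYdd, ψ (η y) = η ⟨γ y, hdd y y.2⟩) :
    ∃ α : (T.modelMono hη).Iso (T.modelMono hη),
      ∀ x : T.env, ((CycEnvelope.proj T.augY T.chi (α.e x) : T.PiY) : T.PiX) =
        γ ((CycEnvelope.proj T.augY T.chi x : T.PiY) : T.PiX) := by
  -- the automorphism `A₀ : (a, g) ↦ (ψ a, γ g)` (pattern of abc-iut-L2-t10's `cor218_iv_surjective_of`)
  let A₀ : MulAut T.env :=
    { toFun := fun x => ⟨ψ x.left, ⟨γ (x.right : T.PiX), hY _ x.right.2⟩⟩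
      invFun := fun x => ⟨ψ.symm x.left, ⟨γ.symm (x.right : T.PiX), hY' _ x.right.2⟩⟩
      left_inv := fun x => by
        ext
        · simp
        · simp
      right_inv := fun x => by
        ext
        · simp
        · simp
      map_mul' := fun x y => by
        ext
        · rw [mul_left_eq, mul_left_eq, map_mul]
        · simp }
  have hr : ∀ x : T.env, (((A₀ x).right : T.PiY) : T.PiX) = γ (x.right : T.PiX) := fun x => rfl
  -- continuity of `A₀`
  have hlc : Continuous fun x : T.env => x.left :=
    (continuous_fst.comp continuous_induced_dom :
      Continuous (Prod.fst ∘ fun x : T.env => (x.left, x.right)))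
  have hrc : Continuous fun x : T.env => ((x.right : T.PiY) : T.PiX) :=
    continuous_subtype_val.comp (continuous_snd.comp continuous_induced_dom :
      Continuous (Prod.snd ∘ fun x : T.env => (x.left, x.right)))
  have hA₀c : A₀ ∈ contMulAut T.env := by
    refine ⟨?_, ?_⟩
    · refine continuous_induced_rng.2 ?_
      change Continuous fun x : T.env =>
        ((ψ x.left, (⟨γ (x.right : T.PiX), hY _ x.right.2⟩ : T.PiY)) : T.mu × T.PiY)
      exact ((continuous_of_discreteTopology (f := fun a : T.mu => ψ a)).comp hlc).prodMk
        ((γ.continuous.comp hrc).subtype_mk _)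
    · refine continuous_induced_rng.2 ?_
      change Continuous fun x : T.env =>
        ((ψ.symm x.left, (⟨γ.symm (x.right : T.PiX), hY' _ x.right.2⟩ : T.PiY)) : T.mu × T.PiY)
      exact ((continuous_of_discreteTopology (f := fun a : T.mu => ψ.symm a)).comp hlc).prodMk
        ((γ.symm.continuous.comp hrc).subtype_mk _)
  set cA : contMulAut T.env := ⟨A₀, hA₀c⟩ with hcA
  -- `A₀` carries `s^Θ(y)` to `s^Θ(γ y)`
  have hAs : ∀ y : T.PiYdd, A₀ (T.sTheta hη y) = T.sTheta hη ⟨γ y, hdd y y.2⟩ := by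
    intro y
    refine SemidirectProduct.ext ?_ (Subtype.ext rfl)
    change ψ (η y)⁻¹ = (η ⟨γ y, hdd y y.2⟩)⁻¹
    rw [map_inv, hψ]
  have hs : (T.sTheta hη).range.map (cA : MulAut T.env).toMonoidHom = (T.sTheta hη).range := by
    ext x
    constructor
    · rintro ⟨_, ⟨y, rfl⟩, rfl⟩
      exact ⟨⟨γ y, hdd y y.2⟩, (hAs y).symm⟩
    · rintro ⟨y, rfl⟩
      refine ⟨_, ⟨⟨γ.symm y, hdd' y y.2⟩, rfl⟩, ?_⟩
      change A₀ _ = _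
      rw [hAs]
      exact congrArg _ (Subtype.ext (γ.apply_symm_apply (y : T.PiX)))
  have hDmap : T.DY.map (MulAut.conj (TopOut.mk _ cA)).toMonoidHom = T.DY := by
    rw [hD, Subgroup.map_bot]
  obtain ⟨α, hα⟩ := T.exists_modelIso_of_aut' hη hη cA hDmap
    (fun a => ⟨ψ a, by ext <;> simp [hcA, A₀]⟩)
    (fun b => ⟨ψ.symm b, by ext <;> simp [hcA, A₀]⟩) hs
  exact ⟨α, fun x => by rw [hα]; rfl⟩

/-- **Cor. 2.18 (iv), surjectivity — criterion for `G_K = 1` data**: if `Π^tp_X` acts on `Π^tp_Y` by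
inner automorphisms (so `D_Y = 1`), every automorphism of `Π^tp_X` preserving `Π^tp_Y` also preserves
`Π^tp_Ÿ`, and acts on each theta cocycle through SOME coefficient automorphism of `μ_N`, then
`Cor218_iv_surjective` holds. [cite: MochizukiEtTh2009, Cor 2.18(iv) p.61] -/
theorem cor218_iv_surjective_of_stable
    (hinner : ∀ x : T.PiX, ∃ y : T.PiY, ∀ h : T.PiY,
      x * (h : T.PiX) * x⁻¹ = (y : T.PiX) * h * (y : T.PiX)⁻¹)
    (hstab : ∀ γ : T.PiX ≃ₜ* T.PiX, T.PiY.map γ.toMulEquiv.toMonoidHom = T.PiY →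
      ∀ g : T.PiX, g ∈ T.PiYdd → γ g ∈ T.PiYdd)
    (hcoeff : ∀ (γ : T.PiX ≃ₜ* T.PiX) (hγ : ∀ g : T.PiX, g ∈ T.PiYdd → γ g ∈ T.PiYdd)
      (η : T.PiYdd → T.mu), η ∈ T.thetaCocycles →
      ∃ ψ : T.mu ≃* T.mu, ∀ y : T.PiYdd, ψ (η y) = η ⟨γ y, hγ y y.2⟩) :
    Literature.AnabelianGeometry.EtaleTheta.ThetaEnvData.Cor218_iv_surjective T := by
  intro η hη γ hγ
  -- transport of membership along `γ`, `γ⁻¹`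
  have fwd : ∀ (H : Subgroup T.PiX), H.map γ.toMulEquiv.toMonoidHom = H →
      (∀ g ∈ H, γ g ∈ H) ∧ ∀ g ∈ H, γ.symm g ∈ H := by
    intro H hH
    refine ⟨fun g hg => ?_, fun g hg => ?_⟩
    · rw [← hH]; exact ⟨g, hg, rfl⟩
    · have hg' : g ∈ H.map γ.toMulEquiv.toMonoidHom := by rw [hH]; exact hg
      obtain ⟨g₀, hg₀, hg₀eq⟩ := hg'
      have : γ.symm g = g₀ := by
        rw [← hg₀eq]; exact γ.symm_apply_apply g₀
      rw [this]; exact hg₀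
  obtain ⟨hY, hY'⟩ := fwd _ hγ
  have hγ' : T.PiY.map γ.symm.toMulEquiv.toMonoidHom = T.PiY := by
    ext g
    constructor
    · rintro ⟨g₀, hg₀, rfl⟩
      exact hY' g₀ hg₀
    · intro hg
      exact ⟨γ g, hY g hg, γ.symm_apply_apply g⟩
  obtain ⟨ψ, hψ⟩ := hcoeff γ (hstab γ hγ) η hη
  exact T.exists_iso_over_of_coeff (T.DY_eq_bot_of_forall_exists_conj hinner) hη γ hY hY'
    (hstab γ hγ) (fun g hg => by simpa using hstab γ.symm hγ' g hg) ψ hψ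

/-- With `G_K = 1`, an automorphism of the model over `id_{Π^tp_Y}` FIXES the theta section pointwise
(the `μ_N`-conjugacy class of `Im s^Θ` is a singleton). [cite: MochizukiEtTh2009, Cor 2.18(iv) p.63] -/
theorem iso_apply_sTheta_of_over_id {η : T.PiYdd → T.mu} (hη : η ∈ T.thetaCocycles)
    (α : (T.modelMono hη).Iso (T.modelMono hη))
    (hα : ∀ x, CycEnvelope.proj T.augY T.chi (α.e x) = CycEnvelope.proj T.augY T.chi x)
    (y : T.PiYdd) : α.e (T.sTheta hη y) = T.sTheta hη y := by
  have hS := α.map_sTheta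
  change (fun H => H.map α.e.toMulEquiv.toMonoidHom) ''
      CycEnvelope.muConjClass _ _ (T.sTheta hη).range =
    CycEnvelope.muConjClass _ _ (T.sTheta hη).range at hS
  rw [muConjClass_eq_singleton_of_subsingleton, Set.image_singleton,
    Set.singleton_eq_singleton_iff] at hS
  have hx : α.e (T.sTheta hη y) ∈ (T.sTheta hη).range.map α.e.toMulEquiv.toMonoidHom :=
    Subgroup.mem_map_of_mem _ ⟨y, rfl⟩
  rw [hS] at hx
  obtain ⟨y', hy'⟩ := hx
  have h2 : (T.inclYdd y' : T.PiY) = T.inclYdd y := by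
    have h3 := congrArg SemidirectProduct.right hy'
    have h4 : (α.e (T.sTheta hη y)).right = (T.sTheta hη y).right := hα _
    rw [h4] at h3
    exact h3
  have h4 : y' = y := Subgroup.inclusion_injective T.PiYdd_le h2
  rw [← hy', h4]

/-- **Cor. 2.18 (iv), fibres — rigidity criterion for `G_K = 1` data**: if `Hom(Π^tp_Y, μ_N) = 1` and
every theta cocycle is ONTO `μ_N`, then every automorphism `α` of the model over `id_{Π^tp_Y}` is the
identity (`α` fixes `s^Θ` pointwise; `y ↦ (α s^alg(y))·s^alg(y)⁻¹` is a homomorphism `Π^tp_Y → μ_N`, hence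
trivial; comparing on `Π^tp_Ÿ`, `α` is the identity on `η(Π^tp_Ÿ) = μ_N`), so `Cor218_iv_fibre` holds (the
converse clause is abc-iut-L2-t10's `exists_iso_eq_twist`). [cite: MochizukiEtTh2009, Cor 2.18(iv) p.63] -/
theorem cor218_iv_fibre_of_rigid (hhom : ∀ f : T.PiY →* T.mu, f = 1)
    (hsurj : ∀ η ∈ T.thetaCocycles, Function.Surjective η) :
    Literature.AnabelianGeometry.EtaleTheta.ThetaEnvData.Cor218_iv_fibre T := by
  intro η hη
  refine ⟨fun α hα => ⟨1, fun _ => rfl, 1, fun x => ?_⟩, fun φ hφ => T.exists_iso_eq_twist hη φ hφ⟩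
  let A : MulAut T.env := α.e.toMulEquiv
  have hAe : ∀ x, α.e x = A x := fun x => rfl
  have hAright : ∀ x, (A x).right = x.right := hα
  -- the homomorphism `f : y ↦ (A s^alg(y)).left`
  let sY : T.PiY →* T.env := CycEnvelope.algSection T.augY T.chi
  let f : T.PiY →* T.mu := MonoidHom.mk' (fun y => (A (sY y)).left) (fun y y' => by
    change (A (sY (y * y'))).left = (A (sY y)).left * (A (sY y')).left
    rw [map_mul, map_mul, mul_left_eq])
  have hf : ∀ y, (A (sY y)).left = 1 := fun y => by
    have := congrArg (fun g : T.PiY →* T.mu => g y) (hhom f)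
    simpa [f] using this
  have hAsY : ∀ y, A (sY y) = sY y := fun y =>
    SemidirectProduct.ext (by rw [hf]; rfl) (by rw [hAright])
  -- `A` on the cyclotome: `A (inMu a) = inMu (g a)` with `g` the identity
  have hAμ : ∀ a, A (CycEnvelope.inMu T.augY T.chi a) =
      CycEnvelope.inMu T.augY T.chi (A (CycEnvelope.inMu T.augY T.chi a)).left := by
    intro a
    ext
    · simp
    · rw [hAright]; simp
  have hfix : ∀ a, A (CycEnvelope.inMu T.augY T.chi a) = CycEnvelope.inMu T.augY T.chi a := by
    intro a
    obtain ⟨y, rfl⟩ := hsurj η hη a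
    -- `s^alg(y) = η(y) · s^Θ(y)` and `A` fixes `s^alg(y)`, `s^Θ(y)`
    have h1 : sY (T.inclYdd y) = CycEnvelope.inMu T.augY T.chi (η y) * T.sTheta hη y := by
      ext
      · simp [sY, ThetaEnvData.sTheta]
      · simp [sY, ThetaEnvData.sTheta]
    have h2 := hAsY (T.inclYdd y)
    rw [h1, map_mul, ← hAe (T.sTheta hη y), T.iso_apply_sTheta_of_over_id hη α hα y] at h2
    exact mul_right_cancel h2
  -- conclusion: `A x = x`
  have hAx : A x = x :=
    calc A x = A (CycEnvelope.inMu T.augY T.chi x.left * sY x.right) := by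
          rw [CycEnvelope.inMu_mul_algSection]
      _ = x := by rw [map_mul, hfix, hAsY, CycEnvelope.inMu_mul_algSection]
  rw [hAe, hAx]
  simp only [MonoidHom.one_apply, map_one, MulAut.one_apply, one_mul]

end SubsingletonG

end ThetaEnvData

end Literature.AnabelianGeometry.EtaleTheta
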